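import Literature.AlgebraicGeometry.ModuliOfAbelianVarieties.SiegelFineModuliSchemeOfCores   -- F-12-of-cores: ED. 3 ★ p796022 head `exists_threshold_siegelFineModuliScheme_of_cores''` (row 4, F0P1a-p01 (g2); Q7) — ED. 2 `…of_cores'` ★ p793324 (Q4) kept in the same file
import Literature.AlgebraicGeometry.ModuliOfAbelianVarieties.SiegelFineModuliSchemeLevelDescent   -- ★ p766238 F-10 LEVEL DESCENT `lan2013_siegelFineModuliScheme_of_large_levels` (over L11; stale until the L11 rebuild)
import Summits.HodgeConjecture.HodgeConjecture.Theorems.EquidimRelDimOfF   -- ★ E-road junction `HDel_of_F_E : lan2013_siegelFineModuliScheme → HDel` (crux decl by name)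
import Literature.AlgebraicGeometry.AbelianSchemes.AbelianSchemeDualPair   -- F-3 letters (Z)(L)(K)(M): `AbelianSchemeOver.DualPair`, `baseChange`, `unitSection`
import Literature.AlgebraicGeometry.AbelianSchemes.AbelianSchemeKOfLEtaleOfConstantRank   -- F-3 (K)(M): `MemKOfL`, `HasRank`, `detClass`, `CechPic`, `CartierDivisor`, `fibre`
import Literature.AlgebraicGeometry.AbelianSchemes.AbelianSchemeKOfLFlat   -- ★ p789144 (K) closer `AbelianSchemeOver.exists_kOfL_etale` (B-p08 (g15)); ed. 1.1 of this line = tree F-3 ed. 1.3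
import Literature.AlgebraicGeometry.AbelianSchemes.ProjectiveAbelianSchemeAmpleClass   -- ★ p788891 (L) closer `AbelianSchemeOver.exists_affine_rigidified_fibrewise_ample_of_isProjective` (B-p12 (g18)); ed. 1.2 of this line = tree F-3 ed. 1.4
import Literature.AlgebraicGeometry.AbelianSchemes.PolarizedLevelPushforwardDetClass   -- ★ p792358 (M2b) ED. 2 `def SiegelFramedCovariant.PL` (Q2, 22:13Z): the `.PL` token of the letter `stub_PL`, imported DIRECTLY (ed. 1.2) rather than only through F-12
import Literature.AlgebraicGeometry.Morphisms.ProjectiveMorphism   -- `Morphisms.IsProjective`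
import Literature.AlgebraicGeometry.Morphisms.ProjectiveMorphismComposition   -- `IsProjective.comp_isClosedImmersion`, `IsProjective.pullback_snd`
import HarnessLib
import Summits.HodgeConjecture.HodgeConjecture.Theorems.F13PluckerProducerStubPL   -- ed. 1.3: ★ p795314 (Q7: ED. 2 ★ p796000, primed head `stub_PL_of_cores_holds'` with hII″) the Theorems-homed TWIN of the registered F-13 producer sub-line `Cruxes/HDel/Lines/F13PluckerProducer.lean` v1.4 ede89b42 (sorry-free) — `stub_PL` is DISCHARGED BY NAME over its head `stub_PL_of_cores_holds'` (EDITION-BOOK RULING 23:10:50Z: editions import Theorems∕Literature twins, never `Cruxes/…/Lines` workfiles)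
import Literature.AlgebraicGeometry.AbelianSchemes.LinearRigidificationStepTwo   -- ★ p796432 F23 `AbelianSchemeOver.exists_groupLawLocus_of_projective` ([MumfordFogartyKirwan1994] Prop. 6.16 ∕ Thm. 6.14 step (II); F0P1a-p02 (g2)) — `stub_II` (hII″) DISCHARGED BY NAME (registry v5.8 mirror)
import Summits.HodgeConjecture.HodgeConjecture.Theorems.F3DualAbelianSchemeStubF3   -- ed. 1.7: ★ p797885 the Theorems-homed TWIN of the F-3 parent head (`Cruxes/HDel/Lines/F3DualAbelianScheme.lean` §7 `stub_F3`, registry letter token for token; F0P1c-p06 T4 over T0 (Z) ∕ ★ (K) ∕ T3 (M)) — `stub_F3` is DISCHARGED BY NAME over `stub_F3_holds`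
import Summits.HodgeConjecture.HodgeConjecture.Theorems.F11SmoothRoadAStubF11   -- ed. 1.8: ★ p806948 the Theorems-homed TWIN of the F-11 road-A head (`Cruxes/HDel/Lines/F11SmoothRoadA.lean` `stub_F11`, registry letter token for token; B-p05 (g20), F0P1b-plan (g2) (R124)∕(R126)(c)) — `stub_F11` is DISCHARGED BY NAME over `stub_F11_holds`; the P1 head is then SORRY-FREE
import Summits.HodgeConjecture.HodgeConjecture.Theorems.F0FloorSockets   -- ED. 1.7R (R3 head, director s386∕s416 (b)(i)): ★ p796699 Theses-free socket module; `HFType` (abbrev of `lan2013_siegelFineModuliScheme`) = FLOOR-0 socket (F) = route item `F0HF`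


/-!
# Floor-0 LINE P1 `F0-SiegelModuli` — Siegel fine moduli schemes exist (crux `HDel`, item stmt-HodgeConjecture-24835; programme HC_CM FLOOR 0, D-0183)

HC_CM is proved only modulo the 7 printed citations until rung 0 closes; nothing in this file is about Hodge classes.

Author: F0P1-plan (g0) (planner-hodgecm-mathlib-F0P1-plan-g0-0), 2026-08-30, on main's HCML FLOOR-0 NAMING LINE 20:33:03Z and
director-hodgecm-mathlib PLAN v1.3/v1.4 §P1 + s335; pen of the P1 sub-lines tonight = B-plan1 (g19) (BRIEF-P1-state v0 41de8f21).
ED. 1.8 (2026-08-31 03:18Z, ★ p806948 `Theorems/F11SmoothRoadAStubF11` (B-p05 (g20); F0P1b-plan (g2) (R124)∕(R126)(c): ONE end-game twin carrying the F-11 road-A head over ★ MONO-G1 `Theorems/F11StubG1AbelianLift` + ★ MONO-G2 `Theorems/F11StubG2LineBundleLift`), the F11 FOLD — LAST LETTER; cutter F0P1-plan (g2) over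
ED. 1.7R = ED. 1.7 + the R3 head `hF_of_F0` (registrar B-plan1 (g20∕g21), director s416 (b)(i)∕s418)): `stub_F11` is DISCHARGED BY NAME — `theorem stub_F11 : ‹registry letter, bytes unchanged› := F11SmoothRoadA.stub_F11_holds` (FQN frozen by F0P1b-plan (g2) (R124)) over ★ p806948
`F11SmoothRoadAStubF11`, the Theorems-homed TWIN of the F-11 road-A head ([Lan13] Prop. 2.2.4.4 ∕ Thm. 2.2.4.14 deformation road); NO `sorry` remains in this file: `lan2013_siegelFineModuliScheme_holds`, the R3 head `hF_of_F0` and the junction `HDel_holds`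
are closed terms over Mathlib + the ★ Literature∕Theorems files (axioms = the Lean trio) and the registered letter set of this file is ∅ — floor input I-1 `lan2013_siegelFineModuliScheme` DISCHARGED ON MATHLIB ALONE; HC_CM itself is still only proved modulo the
other printed citations until rung 0 closes.


ED. 1.7 (2026-08-31 00:3xZ, T4 ★ p797885 (F0P1c-p06 (g2)), the F3 FOLD): the letter `stub_F3` is DISCHARGED BY ONE NAME — `theorem stub_F3 : ‹registry letter, bytes unchanged› := F3DualAbelianScheme.stub_F3_holds` over ★ p797885 `F3DualAbelianSchemeStubF3`, the
Theorems-homed TWIN of the F-3 parent head (which itself rests on the ★ twins of (Z), (K), (M) and ★ (L)); Part B no longer carries the four F-3 hand letters and the §5–§7 glue by value —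
their record is the registered F-3 line file; the ONE open hand letter of this file is then `stub_F11` (`stub_II` ∕ `stub_PL` ∕ `stub_F3` theorems by name).

ED. 1.6 (2026-08-31, F-3 RE-MIRROR): Part B re-cut BY ANCHORS from the F-3 parent line ed. 1.5 385dca64399f02b5 — (Z) `stub_F3Z` DISCHARGED BY NAME over ★ p797538 `Theorems/F3DualAbelianSchemeStubZ` (`…F3DualAbelianScheme.stub_F3Z_holds`, F0P1c-p04 (g0)); the open F-3 hand letter of this file is then (M) `stub_F3M` only;
imports of the F-3 file not already present are mirrored. Every other byte = the previous edition.

ED. 1.5 (2026-08-30 23:5xZ, the Q7 THREE HUNKS, director g14 s389 ∕ Q7 GO s394 — mirror of registry v5.7): (1) the letter `stub_II` is RE-LETTERED to the PRINT-EXACT step-(II) core hII″ under `∀ (g : ℕ)`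
((β) `IsProjective p₁` hypothesis as in [MumfordFogartyKirwan1994] Prop. 6.16 ∕ Thm. 6.14; (γ) the `IsClosed (Set.range j₂)` conjunct dropped — no consumer), bytes = registry v5.7 TREE `Cruxes/HDel/Lines/F1ExtHodgeType.lean` ad746b4a1a78801c (commit d790cf32a9ff) VERBATIM (opens + docstring + statement); (2) `stub_PL := …F13PluckerProducer.stub_PL_of_cores_holds' stub_II stub_F3` over the twin ED. 2 ★ p796000;
(3) the head applies ★ p796022 `exists_threshold_siegelFineModuliScheme_of_cores''` (F-12-of-cores ED. 3).  `stub_F3`, `stub_PL`, `stub_F11` letters and every other byte unchanged.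
F23 FOLD (registry v5.8 mirror): `stub_II` is DISCHARGED BY NAME — body `Literature.AlgebraicGeometry.AbelianSchemes.AbelianSchemeOver.exists_groupLawLocus_of_projective` over ★ p796432 `AbelianSchemes/LinearRigidificationStepTwo` ([MumfordFogartyKirwan1994] Prop. 6.16 ∕ Thm. 6.14 step (II), F0P1a F23); the REGISTERED STUBS of this file no longer include `stub_II`.

ED. 1.3 (2026-08-30 23:30Z, the PL FOLD booked 22:27:47Z ∕ F0P1d-plan co-sign 22:55:43Z ∕ EDITION-BOOK RULING 23:10:50Z): the letter `stub_PL` is DISCHARGED BY NAME — a THEOREM whose body is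
`F13PluckerProducer.stub_PL_of_cores_holds' stub_II stub_F3` over ★ p795314 `Summits.HodgeConjecture.HodgeConjecture.Theorems.F13PluckerProducerStubPL` (the Theorems-homed twin of the registered F-13 producer sub-line v1.4 ede89b42), moved after Part B so that
`stub_F3` is in scope; every statement byte-identical to ED. 1.2 (342229985bb1dd84, in the tree as e5aed07647f4).  Registered stubs now FOUR: {`stub_II`, `stub_F11`, `stub_F3Z`, `stub_F3M`}.
ED. 1.2 (2026-08-30 22:40Z, one currency with tree F-3 ed. 1.4 7200c2d9 registered by B-plan1 (g19) 22:23:35Z, bytes B-p10 (g14)): the letter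
(L) `stub_F3L` is DISCHARGED BY NAME — its body is the term ★ p788891 `AbelianSchemeOver.exists_affine_rigidified_fibrewise_ample_of_isProjective`
(`AbelianSchemes/ProjectiveAbelianSchemeAmpleClass`, B-p12 (g18)) plus that import and a DIRECT import of ★ p792358 (M2b) ED. 2 (`SiegelFramedCovariant.PL`, Q2); the F-3 blocks are extracted from the tree file BY ANCHORS (opens ∕ §1–§4 letters ∕
§5–§7 glue), every statement and every other byte = ED. 1.1 (a501cfe194ea011f).  Registered stubs now FIVE: {`stub_II`, `stub_PL`, `stub_F11`, `stub_F3Z`, `stub_F3M`}.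
ED. 1.1 (2026-08-30 21:20Z, director s339 (1), one currency with tree F-3 ed. 1.3 bbfb52e6 registered by B-plan1 (g19) 21:11Z): the letter
(K) `stub_F3K` is DISCHARGED BY NAME — its `sorry` is now `exact A.exists_kOfL_etale hL hε hΘ` over ★ p789144 `AbelianSchemes/AbelianSchemeKOfLFlat`
(B-p08 (g15); road T = ★ p787357 · p788917 · p787638 · p788430 · p789144) plus that one import; every statement and every other byte = ed. 1
(d9cfa3ab741de420); registered stubs were then SIX.

STATEMENT (floor input I-1, the letter `Literature/AlgebraicGeometry/ModuliOfAbelianVarieties/SiegelFineModuliSchemeExists.lean:132–135`):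
`lan2013_siegelFineModuliScheme : ∀ (g N : ℕ) (δ : Fin g → ℕ), 0 < g → IsPolarizationType δ → 3 ≤ N → ∃ 𝓜 : SiegelFineModuliScheme g N δ,
Smooth 𝓜.M.hom ∧ IsQuasiProjectiveOver 𝓜.M ∧ IsQuasiProjectiveOver (Over.mk (𝓜.univ.A.X.hom ≫ 𝓜.M.hom))` — [Lan2013PELCompactifications]
Thm. 1.4.1.11 + Cor. 7.2.3.9, [MumfordFogartyKirwan1994] Thm. 7.9 ∕ 7.10: for `g > 0`, a polarisation type `δ` and a level `N ≥ 3` the Siegel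
moduli functor `𝓐_{g,δ,N}` is represented over `ℚ` by a smooth quasi-projective fine moduli scheme with quasi-projective universal family.
JUNCTION: ★ `Summit.HodgeConjecture.HodgeConjecture.Theorems.EquidimRelDimOfF.HDel_of_F_E : lan2013_siegelFineModuliScheme → HDel`
(E-road, sorry-free), so the last theorem of this file `HDel_holds` concludes the crux decl `…Theses.HCCMUnconditional.HDel` BY NAME.

THESIS ∕ STRATEGY.  ONE CURRENCY WITH THE REGISTRY AND THE SUB-LINES: the head `lan2013_siegelFineModuliScheme_holds` is the registry's own
two-step composition (P1 head file `F0/P1/Lines/SiegelModuliExists.lean` 0e146fba, B-plan1 (g19)) — ★ F-12-of-cores ED. 2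
`exists_threshold_siegelFineModuliScheme_of_cores'` ([MFK94] Thm. 7.9 «for `n` large», assembled in the tree from F-9a frames ★, F-5 Hilbert
scheme ★, R-C2 linearly rigidified covariant, F-8 slice-glued fine moduli scheme ★, F-9 quasi-projectivity ★) fed the four cores
`stub_II stub_F3 stub_PL stub_F11`, then ★ F-10 LEVEL DESCENT `lan2013_siegelFineModuliScheme_of_large_levels` (the remark after Thm. 7.9,
Lemma 7.11) — with the XL idea-risk core F-3 (dual abelian schemes over a base, never formalised anywhere) NOT left as one stub but REFINED
into its four registered hand letters (Z)(L)(K)(M) of the tree line `Cruxes/HDel/Lines/F3DualAbelianScheme.lean` ed. 1.2 (9f45cbe0) along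
MUMFORD'S ROAD «`Â := A ⁄ K(L)`» ([MumfordAV1970] §§8, 10–13), whose glue §5–§7 is PROVED here verbatim, so that `stub_F3` is a THEOREM of
this file.  SEVEN REGISTERED STUBS, every letter BYTE-IDENTICAL to its registered source (so any ★ core discharges this file AND the
sub-line files by name in a one-line edition; no new letter ⇒ no new typer ∕ referee box):
* `stub_II`  — F-4 [MFK94] Thm. 6.14 + Prop. 7.3 (II): the abelian-scheme locus with the group law as output data (registry v5.5-C4 digest
  f1cd8dcc; HONEST OVER-STRENGTH LABEL: `[IsProper p₁]` where print has projective, repair (β) booked) — sub-line `F4LinearRigidificationII`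
  (B-p17 (g15) skeleton v0: `stub_IIrep` ⊕ `stub_IIcl`; B-typ03 MENU v5 II-a…II-e);
* `stub_PL`  — F-13 [MFK94] Prop. 7.4 + §7.2 (*) ∕ Def. 7.5 ∕ Prop. 6.13 (ii)(iv): the Plücker letter of the linearly rigidified covariant
  (digest ac053021) — sub-line `F13PluckerProducer` (card c89f5782; B-p10 (g13) seeds P0∕P1∕P2a∕P2b GREEN; open P3 unit cocycle, P4);
* `stub_F11` — F-11 [Lan13] Thm. 1.4.1.11 ∕ Prop. 2.2.4.4 ∕ Thm. 2.2.4.14: smoothness over `ℚ` (digest 28b2d430) — tree sub-line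
  `Cruxes/HDel/Lines/F11SmoothRoadA.lean` (9513a5b0; ED. 2′ re-cut α1 ∕ α2′ in HOME, B-p05 (g19));
* `stub_F3Z` — F-3 (Z): dual pairs GLUE along an open cover of the base (Zariski gluing from the `DualPair.universal` cocycle; HOME: closed
  modulo the P-a socket, B-p06 (g14) ∕ B-p15 (g15) ∕ B-p18 (g21));
* `stub_F3L` — F-3 (L): projective ⇒ affine-locally a rigidified rank-one `L` fibrewise of ample class, on a CONNECTED Noetherian chart
  (projective geometry; HOME: CLOSED, B-p12 (g18) `ProjectiveAbelianSchemeAmpleClass` v5, lane-P FIFO);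
  — ED. 1.2: DISCHARGED (a THEOREM here and in tree ed. 1.4, by name over ★ p788891)
* `stub_F3K` — F-3 (K): `K(L)` finite ÉTALE over a Noetherian affine `ℚ`-base ([MumfordAV1970] §13 + §16 Riemann–Roch + infinitesimal
  lifting; HOME: CLOSED, B-p08 (g15), T3 ★ p787638, T2 ★ p787357);
  — ED. 1.1: DISCHARGED (a THEOREM here and in tree ed. 1.3; Summits closer `Theorems/F3DualAbelianSchemeStubK.lean` = B-p08's lane-P file, s339 (2))
* `stub_F3M` — F-3 (M), THE HARDEST STUB: Mumford's construction `Â := A ⁄ K(L)`, Poincaré bundle = descent of `Λ(L)`, universality over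
  ALL `T → Spec R`, Galois base-quotient descent ([MumfordAV1970] §13 Thm. p. 125; [MFK94] Cor. 6.8) — tree child line
  `Cruxes/HDel/Lines/F3DualAbelianSchemeM.lean` ed. 4 (8047f009: Ma0 ∕ Ma ∕ Mb ∕ Md1–3 closed in HOME; open = (Mc) UNIVERSALITY only,
  grandchild skeleton B-p02 (g16) ef3c28a3, N3′ slim relative tower S-a…S-f).
Then §B5 `dualPair_of_isProjective` ([MFK94] Cor. 6.8 in print form) and §B7 `stub_F3` (the registry letter, digest 343c289e) are PROVED
from (Z)(L)(K)(M) (B-typ01 (g17) menu §4 proof, tree ed. 1.2 verbatim), §C1 the HEAD, §C2 the JUNCTION `HDel_holds`.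
The plan's map S1–S7 (director PLAN v1.1 §P1): S1 Hilbert scheme = F-5 ★ (no stub) · S2 dual abelian scheme = `stub_F3Z∕L∕K∕M` · S3 = F-6 ★
dissolved · S4 Serre ∕ level descent = F-8 ∕ F-10 ★ · S5 GIT-free slice road = F-8 ★ + F-9 ★ + `stub_PL` · S6 torsor descent ⇒ represents =
F-8 (8δ) ∕ 2B ★ + R2⁺ L10 ∕ L12 ∕ L14 ★ + F-12 + `stub_II` · S7 smoothness = `stub_F11`.

MATHLIB REUSE MAP (what the letters are typed over).  Mathlib: `AlgebraicGeometry.Scheme`, `Spec (.of R)`, `Scheme.OpenCover` ∕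
`Scheme.Cover.mkOfCovers`, morphism classes `IsOpenImmersion` `IsClosedImmersion` `IsProper` `IsFinite` `Smooth` `LocallyOfFiniteType`
`IsSeparated`, `IsLocallyNoetherian` + `isLocallyNoetherian_of_isOpenImmersion`, `CategoryTheory.Limits.pullback` ∕ `IsPullback.isoPullback`,
`CategoryTheory.Over`, `MonObj` ∕ `GrpObj` (group objects in `Over`), `IsNoetherianRing`, `Algebra ℚ R`, `ConnectedSpace`, `IsAlgClosed`,
`Set.range`, `Nat.card`.  Tree (`Literature/AlgebraicGeometry/**`, all ★): `AbelianSchemes.AbelianSchemeOver` (+ `baseChange`, `fibre`,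
`unitSection`, `IsBaseChangeVia`, `DualPair`, `MemKOfL`, `quotientBy`, `mumfordBundle`), `Modules.HasRank` ∕ `detClass` ∕ `CechPic`,
`AbelianVarieties.CartierDivisor` (+ `IsAmple`, `cechClass`), `Morphisms.IsProjective` ∕ `Etale` ∕ `GeometricallyConnected` ∕
`SmoothOfRelativeDimension`, `ModuliOfAbelianVarieties.SiegelFineModuliScheme` ∕ `SiegelFramedCovariant` (+ `.PL`, (M2b) ED. 2) ∕
`IsPolarizationType` ∕ `polarizationDegree`, `HodgeTheory.IsQuasiProjectiveOver`.  Nothing is restated: every carrier is cited by name.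

`lean check`: BY IMPORT this module elaborates once F-12-of-cores ED. 2 (Q4) AND (M2b) ED. 2 `def SiegelFramedCovariant.PL` (Q2) are ★ and
the farm tree is rebuilt past both ((M2b) ED. 2 = ★ p792358 since 22:13Z; Q4 pending); before that it is certified BY PASTE (cert `F0/P1/Lines/F0-SiegelModuli.bypaste.cert.lean`, named on
the cell bus with rc ∕ sorries ∕ axioms).  NO `sorry` in this file (ed. 1.3: `stub_PL` by name; ed. 1.5: `stub_II` by name (F23); ed. 1.6: (Z) by name; ed. 1.7: `stub_F3` by ONE name (T4); ed. 1.8: `stub_F11` by name — LAST LETTER); `stub_F3K`, `stub_F3`, `lan2013_siegelFineModuliScheme_holds` and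
`HDel_holds` are sorry-free given them (`--axioms` = propext ∕ Classical.choice ∕ Quot.sound ⊕ sorryAx through the stubs only).
No `def`, `instance`, `notation`, `axiom`; no `set_option`.  REGISTRATION: published by the 24835 registrar (B-plan2 (g15) → B-plan1 (g19))
with `ledger crux write stmt-HodgeConjecture-24835 Lines/F0-SiegelModuli.lean|.md` — see the card `F0-SiegelModuli.md`; NO `ledger skeleton check` on the served item unless the
director words it (it would replace the served registry record `F1ExtHodgeType` {`stub_Flarge`}); the F0 support-item home on route
HCCMUnconditional is the director's batched `route edit` (s335), after which this file's head `lan2013_siegelFineModuliScheme_holds`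
matches that item's decl by name.
-/

noncomputable section

namespace Summit.HodgeConjecture.CorCM.Cruxes.HypDel.F0SiegelModuli

/-! ## Part A — the registry letters II ∕ PL ∕ F11 (bytes = `F0/P1/Lines/SiegelModuliExists.lean` 0e146fba :46–70, :85–96, :98–104 = registry v5.5-C4 digests II f1cd8dcc · PL ac053021 · F11 28b2d430) -/

open CategoryTheory CategoryTheory.Limits AlgebraicGeometry TopologicalSpace Literature.AlgebraicGeometry.AbelianSchemes Literature.AlgebraicGeometry.Motives Literature.AlgebraicGeometry.ModuliOfAbelianVarieties Literature.AlgebraicGeometry.AbelianSchemes.PolarizedAbelianSchemeWithLevel Literature.AlgebraicGeometry.AbelianSchemes.AbelianSchemeOver in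
open MonObj in
open Literature.AlgebraicGeometry.Morphisms (IsProjective) in
/-- **stub (FACT) CORE II — SERVED LETTER hII″ FROM v5.7 = [MumfordFogartyKirwan1994] Ch. 6 §3 Prop. 6.16 + Thm. 6.14 (representability half) ∕ Ch. 7 §2 Prop. 7.3
step (II), PROJECTIVE `p₁`, group law as output DATA: for every `g`, for a PROJECTIVE smooth geometrically connected `p₁ : Z₁ → H₁` over a ℚ-scheme
locally of finite type with a section `ε₁`, the locus where the fibres carry an abelian-scheme structure of relative dimension `g` with identity `ε₁`
is an OPEN subscheme `j₂ : H₂ ↪ H₁` over which `Z₁` IS a group scheme smooth of relative dimension `g`, universally — the cell's (β)+(γ) letter hII″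
(B-p17 (g15) `hII-double-prime.letter` 3c9b9074) with `∀ (g : ℕ)` in front = the binder `hII''` of ★ F-12-of-cores ED. 3
`exists_threshold_siegelFineModuliScheme_of_cores''` VERBATIM = the statement of the F-4 line theorem `Cruxes/HDel/Lines/F4LinearRigidificationII.lean`
`stub_IIrep'` character for character (PROVED there modulo its layer-2 letters, all closed in HOME).** [GENERIC-WITH-DATA].  ≤ PRINT VERBATIM: (β) print
states Prop. 6.16 ∕ Thm. 6.14 for PROJECTIVE abelian schemes — the v5.5∕v5.6 letter had `proper` (stronger than print, REF1 g13 m14, s279 (1b)) and is hereby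
repaired; (γ) the `IsClosed (Set.range j₂)` conjunct of Thm. 6.14's third step (Koizumi) is DROPPED — no consumer in the tree used it (FILE 2 destructured it
away).  CLOSES BY NAME of ★ `Literature.AlgebraicGeometry.AbelianSchemes.AbelianSchemeOver.exists_groupLawLocus_of_projective`
(`AbelianSchemes/LinearRigidificationStepTwo.lean`, F0P1a F23) when filed: `stub_II := AbelianSchemeOver.exists_groupLawLocus_of_projective`.
[cite: MumfordFogartyKirwan1994, Ch. 6 §3 Proposition 6.16 (p. 126), Theorem 6.14 (p. 124); Ch. 7 §2 Proposition 7.3, step (II) (p. 132); Ch. 6 §3 Proposition 6.15 (p. 124), §1 Corollary 6.6 (p. 117)] -/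
theorem stub_II : ∀ (g : ℕ) ⦃H₁ Z₁ : Scheme.{0}⦄ (p₁ : Z₁ ⟶ H₁) [IsProper p₁] [Smooth p₁] [GeometricallyConnected p₁]
    (_ : IsProjective p₁)
    (f₁ : H₁ ⟶ Spec (.of ℚ)) [LocallyOfFiniteType f₁] (ε₁ : H₁ ⟶ Z₁) (_ : ε₁ ≫ p₁ = 𝟙 H₁),
    ∃ (H₂ : Scheme.{0}) (j₂ : H₂ ⟶ H₁) (_ : IsOpenImmersion j₂)
    (G : GrpObj (Over.mk (pullback.snd p₁ j₂))),
      (@MonObj.one _ _ _ (Over.mk (pullback.snd p₁ j₂)) G.toMonObj).left ≫ pullback.fst p₁ j₂ = j₂ ≫ ε₁ ∧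
      SmoothOfRelativeDimension g (pullback.snd p₁ j₂) ∧
      ∀ ⦃T : Scheme.{0}⦄ (v : T ⟶ H₁),
        (∃! w : T ⟶ H₂, w ≫ j₂ = v) ↔
          ∃ G' : GrpObj (Over.mk (pullback.snd p₁ v)),
            (@MonObj.one _ _ _ (Over.mk (pullback.snd p₁ v)) G'.toMonObj).left ≫ pullback.fst p₁ v = v ≫ ε₁ ∧
            SmoothOfRelativeDimension g (pullback.snd p₁ v) :=
  Literature.AlgebraicGeometry.AbelianSchemes.AbelianSchemeOver.exists_groupLawLocus_of_projective

/- `stub_PL` — ed. 1.3: DISCHARGED BY NAME; the letter now stands (as a theorem, statement bytes unchanged) in Part B′ below, after `stub_F3` is proved. -/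

open CategoryTheory CategoryTheory.Limits AlgebraicGeometry TopologicalSpace Literature.AlgebraicGeometry.AbelianSchemes Literature.AlgebraicGeometry.Motives Literature.AlgebraicGeometry.ModuliOfAbelianVarieties Literature.AlgebraicGeometry.AbelianSchemes.PolarizedAbelianSchemeWithLevel Literature.AlgebraicGeometry.AbelianSchemes.AbelianSchemeOver in
open Literature.AlgebraicGeometry.Morphisms (IsProjective projectiveSpaceInt) in
open Literature.AlgebraicGeometry.HodgeTheory (IsQuasiProjectiveOver) in
/-- **CORE F11 (ed. 1.8: DISCHARGED BY NAME over ★ p806948 `F11SmoothRoadA.stub_F11_holds`, the Theorems-homed twin of the F-11 road-A head) = smoothness over ℚ of an abstract fine moduli scheme locally of finite type (frozen letter, B-p13 form; statement = the registry letter, bytes unchanged)** [MODULI-STANDARD].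
[cite: Lan2013PELCompactifications, Thm. 1.4.1.11 (p. 91), Prop. 2.2.4.4 (p. 144) and Thm. 2.2.4.14 (p. 150)] -/
theorem stub_F11 : ∀ (g N : ℕ) (δ : Fin g → ℕ), 0 < g → IsPolarizationType δ → 3 ≤ N →
    ∀ 𝓜 : SiegelFineModuliScheme g N δ, LocallyOfFiniteType 𝓜.M.hom → Smooth 𝓜.M.hom :=
  -- F11 DISCHARGED BY NAME (ed. 1.8): ★ p806948 `F11SmoothRoadAStubF11`
  Summit.HodgeConjecture.CorCM.Cruxes.HypDel.F11SmoothRoadA.stub_F11_holds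


/-! ## Part B — core F-3 DISCHARGED BY ONE NAME (ed. 1.7) over ★ p797885 `Summits.HodgeConjecture.HodgeConjecture.Theorems.F3DualAbelianSchemeStubF3`, the
Theorems-homed TWIN of the F-3 parent head `Cruxes/HDel/Lines/F3DualAbelianScheme.lean` §7 (F0P1c-p06 T4; it rests on the ★ twins of the hand letters
(Z) `…StubZ`, (K) `…StubK` p792729, (M) `…StubM` and on ★ (L) p788891).  The statement below is the registry-24835 letter `stub_F3` VERBATIM (= the F-3 file §7,
= capstone binder `hF3`); the four hand letters and the §5–§7 glue that editions 1–1.3 carried here BY VALUE are now record of the registered F-3 line file only.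
[cite: MumfordFogartyKirwan1994, Ch. 6 §1 Corollary 6.8 (p. 118)] [cite: Lan2013PELCompactifications, Thm. 1.3.2.3 (p. 70)] -/

section F3

open CategoryTheory CategoryTheory.Limits AlgebraicGeometry
open Literature.AlgebraicGeometry.AbelianSchemes Literature.AlgebraicGeometry.Motives
  Literature.AlgebraicGeometry.AbelianVarieties Literature.AlgebraicGeometry.Modules
open Literature.AlgebraicGeometry.Morphisms (IsProjective)

/-- **CORE F3 (ed. 1.7: DISCHARGED BY NAME over ★ p797885 `F3DualAbelianScheme.stub_F3_holds`)** = letter «dual pairs Zariski-locally of projective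
abelian schemes» of registry 24835, statement VERBATIM. [cite: MumfordFogartyKirwan1994, Ch. 6 §1 Corollary 6.8 (p. 118)] -/
theorem stub_F3 : ∀ ⦃S : Scheme.{0}⦄ [IsLocallyNoetherian S] (_fS : S ⟶ Spec (.of ℚ)) (A : AbelianSchemeOver S),
    (∀ s : S, ∃ (U : Scheme.{0}) (i : U ⟶ S) (_ : IsOpenImmersion i) (_ : s ∈ Set.range i.base)
      (B : AbelianSchemeOver U) (G : B.X.left ⟶ A.X.left), B.IsBaseChangeVia A i G ∧ IsProjective B.X.hom) →
    Nonempty A.DualPair :=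
  Summit.HodgeConjecture.CorCM.Cruxes.HypDel.F3DualAbelianScheme.stub_F3_holds

end F3

/-! ## Part B′ — the Plücker letter `stub_PL` DISCHARGED BY NAME (ed. 1.3) over ★ p795314 `Summits.HodgeConjecture.HodgeConjecture.Theorems.F13PluckerProducerStubPL`, the
Theorems-homed TWIN of the registered F-13 producer sub-line `Cruxes/HDel/Lines/F13PluckerProducer.lean` v1.4 ede89b42 (F0-typ2 (g0); sorry-free;
head `stub_PL_of_cores_holds' (hII) (hF3)`), fed with this file's `stub_II` (registered letter, open) and `stub_F3` (theorem, §7 above).  One currency: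
the twin's binders `hII` ∕ `hF3` are the registry letters II ∕ F3 token for token (F0P1-plan check 22:58Z on the producer head: 231∕231 and 93∕93
tokens; conclusion ≡ `stub_PL` 65∕65); editions import Theorems∕Literature twins, never `Cruxes/…/Lines` workfiles (EDITION-BOOK RULING 23:10:50Z). -/

open CategoryTheory CategoryTheory.Limits AlgebraicGeometry TopologicalSpace Literature.AlgebraicGeometry.AbelianSchemes Literature.AlgebraicGeometry.Motives Literature.AlgebraicGeometry.ModuliOfAbelianVarieties Literature.AlgebraicGeometry.AbelianSchemes.PolarizedAbelianSchemeWithLevel Literature.AlgebraicGeometry.AbelianSchemes.AbelianSchemeOver in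
/-- **CORE PL (ed. 1.3: DISCHARGED BY NAME over ★ p795314 `F13PluckerProducer.stub_PL_of_cores_holds' stub_II stub_F3`, the Theorems-homed twin of the registered F-13 producer; statement = the registry letter, bytes unchanged) = the Plücker letter of the linearly rigidified covariant: every `𝓗 : SiegelFramedCovariant g N δ J` locally of finite
type over ℚ (`N ≥ 3`, `#J + 1 = 6^g·d`) satisfies ★ `SiegelFramedCovariant.PL` — `H` quasi-compact, IMMERSED `ι_H : H → 𝐏^r_ℚ` over its structure
map, the class of `ι_H^*𝒪(m)` an integer combination of the determinants `[det π_*(L^Δ(λ)^{⊗k})]` and of the section classes `[sec_a^*L^Δ(λ)]` —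
the binder `hPL` of ★ F-12-of-cores ED. 2 VERBATIM (the print-located residue of (H-rep) after R2⁺; director g12 s276 (i); REF1 (g13) m09∕m11 + ref2
l23∕l24 ≤-print reads of record: EXISTENCE of `ι_H` = Prop. 7.4, the IDENTITY = the intrinsic form of the `PGL(m+1)`-linearisation, print-derived
from §7.2 (*), Def. 7.5, Prop. 6.13 (ii)(iv)).** [MODULI-STANDARD (GIT)].
[cite: MumfordFogartyKirwan1994, Ch. 7 §2 Proposition 7.4 (p. 135), §7.2 (*) (p. 131), Definition 7.5 (p. 130), Proposition 7.3 (p. 132)]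
[cite: MumfordFogartyKirwan1994, Ch. 6 §2 Proposition 6.13 (ii)(iv) (p. 123)] -/
theorem stub_PL : ∀ ⦃g N : ℕ⦄ ⦃δ : Fin g → ℕ⦄ ⦃J : Type⦄ [Finite J], 0 < g → IsPolarizationType δ → 3 ≤ N →
    Nat.card J + 1 = 6 ^ g * polarizationDegree δ →
    ∀ 𝓗 : SiegelFramedCovariant g N δ J, LocallyOfFiniteType 𝓗.H.hom → 𝓗.PL :=
  Summit.HodgeConjecture.CorCM.Cruxes.HypDel.F13PluckerProducer.stub_PL_of_cores_holds' stub_II stub_F3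

/-! ## Part C — the HEAD (floor input I-1 by name) and the JUNCTION (crux decl `HDel` by name) -/

/-- **HEAD (Floor-0 line P1) — ★ `lan2013_siegelFineModuliScheme` BY NAME, a THEOREM over the four registered cores**: for `0 < g`, a polarisation type
`δ` and `N ≥ 3` the Siegel moduli functor `𝓐_{g,δ,N}` is represented by a fine moduli scheme, smooth and quasi-projective over `ℚ`, with quasi-projective
universal family.  Proof = the registry's own two steps (v5.5-C4 :292–312): ★ F-12-of-cores ED. 3 `exists_threshold_siegelFineModuliScheme_of_cores''` (Q7: the step-(II) core in its PRINT-EXACT form hII″) fed the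
cores `stub_II stub_F3 stub_PL stub_F11` in its binder order ([MumfordFogartyKirwan1994] Thm. 7.9 «for `n` large»), then ★ F-10 LEVEL DESCENT
`lan2013_siegelFineModuliScheme_of_large_levels β h` (the remark after Thm. 7.9 «true even if `n ≥ 3`», Lemma 7.11; [Lan2013PELCompactifications] Cor. 1.4.1.12).
[cite: MumfordFogartyKirwan1994, Ch. 7 §3 Theorem 7.9 with the remark following it and Theorem 7.10 (p. 139)]
[cite: Lan2013PELCompactifications, Thm. 1.4.1.11 (p. 91) and Cor. 7.2.3.9 (p. 518)] -/
theorem lan2013_siegelFineModuliScheme_holds :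
    Literature.AlgebraicGeometry.ModuliOfAbelianVarieties.lan2013_siegelFineModuliScheme := by
  -- [MFK94] Thm. 7.9 «for `n` large»: the threshold `β` and the fine moduli carriers at every level `N ≥ β g δ`, from the four cores
  obtain ⟨β, h⟩ :=
    Literature.AlgebraicGeometry.ModuliOfAbelianVarieties.exists_threshold_siegelFineModuliScheme_of_cores''
      stub_II stub_F3 stub_PL stub_F11
  -- the remark after Thm. 7.9 «true even if `n ≥ 3`»: ★ F-10 level descent
  exact Literature.AlgebraicGeometry.ModuliOfAbelianVarieties.lan2013_siegelFineModuliScheme_of_large_levels β h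

/-- **R3 HEAD (ED. 1.7R; registrar B-plan1 (g20) cut, director s416 (b)(i))** — FLOOR-0 socket (F) BY NAME: the file head
`lan2013_siegelFineModuliScheme_holds` read at the Theses-free socket type `Summit.HodgeConjecture.HodgeConjecture.Theorems.F0FloorSockets.HFType`
(★ p796699; `abbrev HFType := lan2013_siegelFineModuliScheme`, so the term is the head itself) — the theorem the R3 verb
`ledger skeleton check … --crux stmt-HodgeConjecture-27454 --crux-decl Summit.HodgeConjecture.HodgeConjecture.Theorems.F0FloorSockets.HFType` keyed on (R2: item `F0HF` = stmt-HodgeConjecture-27454, director s426; R3 #1, B-plan1 (g21) 2026-08-31 02:33Z on ED. 1.7R: «stubs registered on stmt-HodgeConjecture-27454: stub_F11»; conclusion BY NAME, no unfolding).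
ED. 1.7R changed no statement, stub or proof of ED. 1.7; as of ED. 1.8 (`stub_F11` by name) this head is a CLOSED term (Lean trio) and the registered letter set of this file is ∅. HC_CM is proved only modulo the 7 printed citations until rung 0 closes. -/
theorem hF_of_F0 : Summit.HodgeConjecture.HodgeConjecture.Theorems.F0FloorSockets.HFType :=
  lan2013_siegelFineModuliScheme_holds

/-- **JUNCTION `HDel_holds` — the crux decl `Summit.HodgeConjecture.HodgeConjecture.Theses.HCCMUnconditional.HDel` BY NAME**, from the head
through the ★ E-road theorem `EquidimRelDimOfF.HDel_of_F_E` ((F) ⇒ hDel: the Siegel fine moduli scheme is smooth of relative dimension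
`g(g+1)/2` and the CM Hecke-quotient family is equidimensional; sorry-free in the tree).  HC_CM is proved only modulo the 7 printed
citations until rung 0 closes. [cite: Lan2013PELCompactifications, Thm. 1.4.1.11 (p. 91)] -/
theorem HDel_holds : Summit.HodgeConjecture.HodgeConjecture.Theses.HCCMUnconditional.HDel :=
  Summit.HodgeConjecture.HodgeConjecture.Theorems.EquidimRelDimOfF.HDel_of_F_E lan2013_siegelFineModuliScheme_holds

end Summit.HodgeConjecture.CorCM.Cruxes.HypDel.F0SiegelModuli

end
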